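import Mathlib.Tactic
import HarnessLib

/-!
# Design (D) CONCENTRIC — the radius recursion of ENTRY-SEED-STAR §11 v2 as pure `ℕ`-arithmetic (refuter's D-CHECKLIST D1)

builds on p205010 (kernel theorem, internal audit signed; external expert review pending) — nothing in this file uses p205010.
Lane `prim-bschramm`, lead seat (gen 2) for p3-g2's instance work I2; helper file (`--supports stmt-CriticalPhenomena-4575`).

Per depth `b` the concentric instance uses three fibre radii `E (b-1) < F b < E b` (p3-g2's habitat analysis, lead ruling 14:1xZ):
the corridor sets of depth `b` carry `E (b-1)`, the far box (habitat of the `cond_j` chains) carries `F b`, the cube/between boxes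
(habitat of the next `hreach` chain, whose source is the hand-over cube of radius `≤ F b`) carry `E b`.  Given two gap functions
`gap gap' : ℕ → ℕ` (instantiated later by choice from the collar/excess lemma and the chain-step drift) and a root radius `E₀`:
* `Erad gap gap' E₀ b`, `Frad gap gap' E₀ b` — `E 0 = E₀`, `F (b+1) = E b + gap (E b)`, `E (b+1) = F (b+1) + gap' (F (b+1))`;
* the identities `Frad_succ`, `Erad_succ` and the inequalities `Erad_le_Frad_succ`, `Frad_le_Erad`, `Erad_mono`, `Frad_mono`,
  `Erad_add_gap_le_Frad_succ`, `Frad_add_gap'_le_Erad` — exactly the §11 v2 contract, for ANY gap functions.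
[cite: KozmaNitzan2024, §4 pp. 26–27 (the regions E_{v,x}, Q_x, H_{v,x})]
-/

namespace Summit.CriticalPhenomena.PercolationContinuityZ3.Theorems

namespace Transplant

namespace BoxProdZ2

/-- Probe/cube radius `E b` of depth `b` (mutually with `Frad`). [this work] -/
def Erad (gap gap' : ℕ → ℕ) (E₀ : ℕ) : ℕ → ℕ
  | 0 => E₀
  | b + 1 => (Erad gap gap' E₀ b + gap (Erad gap gap' E₀ b)) + gap' (Erad gap gap' E₀ b + gap (Erad gap gap' E₀ b))

/-- Far-box radius `F b` of depth `b` (`F 0 = E₀`, unused). [this work] -/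
def Frad (gap gap' : ℕ → ℕ) (E₀ : ℕ) : ℕ → ℕ
  | 0 => E₀
  | b + 1 => Erad gap gap' E₀ b + gap (Erad gap gap' E₀ b)

variable (gap gap' : ℕ → ℕ) (E₀ : ℕ)

/-- `E 0 = E₀`. [this work] -/
@[simp] theorem Erad_zero : Erad gap gap' E₀ 0 = E₀ := rfl

/-- `F (b+1) = E b + gap (E b)`. [this work] -/
theorem Frad_succ (b : ℕ) : Frad gap gap' E₀ (b + 1) = Erad gap gap' E₀ b + gap (Erad gap gap' E₀ b) := rfl

/-- `E (b+1) = F (b+1) + gap' (F (b+1))`. [this work] -/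
theorem Erad_succ (b : ℕ) : Erad gap gap' E₀ (b + 1) = Frad gap gap' E₀ (b + 1) + gap' (Frad gap gap' E₀ (b + 1)) := rfl

/-- `E b + gap (E b) ≤ F (b+1)` (with equality). [this work] -/
theorem Erad_add_gap_le_Frad_succ (b : ℕ) : Erad gap gap' E₀ b + gap (Erad gap gap' E₀ b) ≤ Frad gap gap' E₀ (b + 1) := le_rfl

/-- `F b + gap' (F b) ≤ E b` for `b ≥ 1` (with equality). [this work] -/
theorem Frad_add_gap'_le_Erad {b : ℕ} (hb : b ≠ 0) : Frad gap gap' E₀ b + gap' (Frad gap gap' E₀ b) ≤ Erad gap gap' E₀ b := by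
  obtain ⟨b', rfl⟩ : ∃ b', b = b' + 1 := ⟨b - 1, by omega⟩
  rw [Erad_succ]

/-- `E (b-1) ≤ F b` (for `b = 0` both are `E₀`). [this work] -/
theorem Erad_pred_le_Frad (b : ℕ) : Erad gap gap' E₀ (b - 1) ≤ Frad gap gap' E₀ b := by
  rcases Nat.eq_zero_or_pos b with rfl | hb
  · simp [Frad]
  · obtain ⟨b', rfl⟩ : ∃ b', b = b' + 1 := ⟨b - 1, by omega⟩
    simp [Frad_succ]

/-- `F b ≤ E b`. [this work] -/
theorem Frad_le_Erad (b : ℕ) : Frad gap gap' E₀ b ≤ Erad gap gap' E₀ b := by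
  rcases Nat.eq_zero_or_pos b with rfl | hb
  · simp [Frad]
  · exact (Nat.le_add_right _ _).trans (Frad_add_gap'_le_Erad gap gap' E₀ (Nat.pos_iff_ne_zero.1 hb))

/-- `E (b-1) ≤ E b`. [this work] -/
theorem Erad_pred_le (b : ℕ) : Erad gap gap' E₀ (b - 1) ≤ Erad gap gap' E₀ b :=
  (Erad_pred_le_Frad gap gap' E₀ b).trans (Frad_le_Erad gap gap' E₀ b)

/-- `E` is monotone in the depth. [this work] -/
theorem Erad_mono : Monotone (Erad gap gap' E₀) := by
  refine monotone_nat_of_le_succ fun b => ?_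
  simpa using Erad_pred_le gap gap' E₀ (b + 1)

/-- `F` is monotone in the depth. [this work] -/
theorem Frad_mono : Monotone (Frad gap gap' E₀) := by
  refine monotone_nat_of_le_succ fun b => ?_
  calc Frad gap gap' E₀ b ≤ Erad gap gap' E₀ b := Frad_le_Erad gap gap' E₀ b
    _ ≤ Frad gap gap' E₀ (b + 1) := by simpa using Erad_pred_le_Frad gap gap' E₀ (b + 1)

/-- With gaps bounded below by `g₀ ≥ 1`-type functions the radii strictly increase: if `1 ≤ gap n` for all `n` then `E b < F (b+1)`.
[this work] -/
theorem Erad_lt_Frad_succ (hgap : ∀ n, 1 ≤ gap n) (b : ℕ) : Erad gap gap' E₀ b < Frad gap gap' E₀ (b + 1) := by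
  rw [Frad_succ]
  have := hgap (Erad gap gap' E₀ b)
  omega

/-- If `1 ≤ gap' n` for all `n` then `F b < E b` for `b ≥ 1`. [this work] -/
theorem Frad_lt_Erad (hgap' : ∀ n, 1 ≤ gap' n) {b : ℕ} (hb : b ≠ 0) : Frad gap gap' E₀ b < Erad gap gap' E₀ b := by
  obtain ⟨b', rfl⟩ : ∃ b', b = b' + 1 := ⟨b - 1, by omega⟩
  rw [Erad_succ]
  have := hgap' (Frad gap gap' E₀ (b' + 1))
  omega

end BoxProdZ2

end Transplant

end Summit.CriticalPhenomena.PercolationContinuityZ3.Theorems
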